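import Mathlib
import Summits.Ventures.PercRepro2.SwOutWeakCubeBlocks
import Summits.Ventures.PercRepro2.SwOutShadowMultiRootJunctions
import Summits.Ventures.PercRepro2.SwAllMarkStepDeco

/-!
# THE ROW FROM WEAK-CUBE BLOCKS: the mark step with any set of junctions on every graph whose
fibres are partitioned into weak cubes (blind cell PercRepro2, night-4 g38, 2026-08-29;
proofs/NIGHT4-G38.md §4)

`WeakCubeBlocks` packages the hypotheses of g36's `rigidOK_g_of_weakCubes` on a part of the
general doubly typed side of a class: a key and a block function such that every side point of the
part lies in its block, every typed point of a block lies in the part with the same key (the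
census's c2 / c5), and every block is the image of an injective cube realisation on which the
typed side pulls back to a lower set, the red edge set of `h` is increasing, and the red edges of
`h` at the antipode of a typed point are blue edges of `h` at the point (c3 / c6 / c7 — design 19's
checks, mining/night-4/g36/shadow19.py, and the block finder's covers, blockfind.py).  Then the
rigid counting inequality holds on the part (`rigidOK_g_of_weakCubeBlocks_part`), on every class
fibred by the escaping set (`rigidOK_g_of_junctions_weakCubes`, g35's fibration verbatim), on the
graph (`gTypedSwAll_of_junctions_weakCubes`), and THE ROW follows:
**`swAll_markStep_of_junctions_weakCubes`**, `sw_markStep_of_junctions_weakCubes` — row 2′SW-ALL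
with the mark `x` on every graph under the weak-cube block structure on every fibre of every pattern
of the mark's edges.  The frozen bases of SwOutFrozenBaseG* are weak-cube blocks
(`FrozenBlocks.toWeakCubeBlocks`, SwOutFrozenBaseGRow); at `n = 7` every one of the 219,240 pairs
carries certified weak-cube blocks (design 14's and design 19's blocks, the block finder's covers of
the 456 pairs left), at `n = 8` (m ≤ 12) 936,042 of the 946,512 pairs.
-/

namespace Summit.Ventures.PercRepro2

namespace LocRows

open Hull

universe u v

variable {V : Type u} {E : Type v}

open scoped Classical

variable {ends : E → Sym2 V}

section Blocks

variable [Fintype E] [DecidableEq E] {U : Set V} {ξ : Config E} {l h : V}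
  {𝓤 𝓓 𝓓'' : Set (Set V)} {X : Set V} {𝓤' : Set (Set V)}

/-- **The weak-cube block structure of a part `P`** (the hypotheses of g36's
`rigidOK_g_of_weakCubes` packaged): a key and a block function; every side point of the part lies
in its block; every typed point of a block lies in the part with the same key; every block is the
image of an injective cube realisation on which the typed side pulls back to a lower set, the red
edge set of `h` is increasing, and the red edges of `h` at the antipode of a typed point are blue
edges of `h` at the point (the census's c3 / c6 / c7; mining/night-4/g36/blockfind.py). -/
def WeakCubeBlocks (ends : E → Sym2 V) (l h : V) (𝓤 𝓓 𝓓'' : Set (Set V)) (X : Set V)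
    (𝓤' : Set (Set V)) (U : Set V) (ξ : Config E) (P : Config E → Prop) : Prop :=
  ∃ (K : Type v) (key : Config E → K) (block : K → Finset (Config E)),
    (∀ ζ ∈ gOutSide ends l h 𝓤 𝓓 𝓓'' X 𝓤' U ξ, P ζ → ζ ∈ block (key ζ)) ∧
    (∀ ζ ∈ gOutSide ends l h 𝓤 𝓓 𝓓'' X 𝓤' U ξ, P ζ → ∀ ζ' ∈ block (key ζ),
      ζ' ∈ gTypedQ ends l h 𝓤 𝓓 𝓓'' X 𝓤' →
        ζ' ∈ gOutSide ends l h 𝓤 𝓓 𝓓'' X 𝓤' U ξ ∧ P ζ' ∧ key ζ' = key ζ) ∧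
    (∀ ζ ∈ gOutSide ends l h 𝓤 𝓓 𝓓'' X 𝓤' U ξ, P ζ →
      ∃ (E' : Type v) (_ : Fintype E') (_ : DecidableEq E') (r : Config E' → Config E),
        Function.Injective r ∧ (∀ ζ', ζ' ∈ block (key ζ) ↔ ∃ ω, r ω = ζ') ∧
          IsLowerSet {ω | r ω ∈ gTypedQ ends l h 𝓤 𝓓 𝓓'' X 𝓤'} ∧
          (∀ 𝓔 : Set (Set E), IsUpperSet 𝓔 → IsUpperSet {ω | redEdges ends (r ω) h ∈ 𝓔}) ∧
          (∀ ω, r ω ∈ gTypedQ ends l h 𝓤 𝓓 𝓓'' X 𝓤' →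
            redEdges ends (r (flipAll ω)) h ⊆ blueEdges ends (r ω) h))



/-- **The rigid inequality on a part from weak-cube blocks** (g36's `rigidOK_g_of_weakCubes` with
the packaged hypothesis). -/
theorem rigidOK_g_of_weakCubeBlocks_part {P : Config E → Prop}
    (hwb : WeakCubeBlocks ends l h 𝓤 𝓓 𝓓'' X 𝓤' U ξ P) {𝓔 : Set (Set E)} (h𝓔 : IsUpperSet 𝓔) :
    ((gOutSide ends l h 𝓤 𝓓 𝓓'' X 𝓤' U ξ).filter fun ζ => P ζ ∧ redEdges ends ζ h ∈ 𝓔).card ≤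
      ((gOutSide ends l h 𝓤 𝓓 𝓓'' X 𝓤' U ξ).filter fun ζ => P ζ ∧ blueEdges ends ζ h ∈ 𝓔).card := by
  obtain ⟨K, key, block, hmem, hblock, hcube⟩ := hwb
  exact rigidOK_g_of_weakCubes key block P hmem hblock hcube h𝓔

/-- **THE MULTI-JUNCTION CLASS FROM WEAK-CUBE BLOCKS**: the rigid counting inequality on the
general doubly typed side of every class, the side fibred by the escaping set, under the weak-cube
block structure on every fibre. -/
theorem rigidOK_g_of_junctions_weakCubes {J : Finset V}
    (hwb : ∀ T ⊆ J, WeakCubeBlocks ends l h 𝓤 𝓓 𝓓'' X 𝓤' U ξ fun ζ =>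
      (∀ r ∈ insert h (↑(J \ T) : Set V), hull ends ζ r ⊆ U) ∧
        (∀ u ∈ (↑T : Set V), ¬ hull ends ζ u ⊆ U))
    {𝓔 : Set (Set E)} (h𝓔 : IsUpperSet 𝓔) :
    ((gOutSide ends l h 𝓤 𝓓 𝓓'' X 𝓤' U ξ).filter fun ζ => redEdges ends ζ h ∈ 𝓔).card ≤
      ((gOutSide ends l h 𝓤 𝓓 𝓓'' X 𝓤' U ξ).filter fun ζ => blueEdges ends ζ h ∈ 𝓔).card := by
  set C := gOutSide ends l h 𝓤 𝓓 𝓓'' X 𝓤' U ξ with hC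
  have hmap : ∀ (P' : Config E → Prop) [DecidablePred P'], ∀ ζ ∈ C.filter P',
      escSetE ends J U ζ ∈ J.powerset :=
    fun _ _ _ _ => Finset.mem_powerset.2 (Finset.filter_subset _ _)
  rw [Finset.card_eq_sum_card_fiberwise (hmap (fun ζ => redEdges ends ζ h ∈ 𝓔)),
    Finset.card_eq_sum_card_fiberwise (hmap (fun ζ => blueEdges ends ζ h ∈ 𝓔))]
  refine Finset.sum_le_sum fun T hT => ?_
  have hTJ : T ⊆ J := Finset.mem_powerset.1 hT
  have hfib : ∀ (P' : Config E → Prop) [DecidablePred P'],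
      (C.filter P').filter (fun ζ => escSetE ends J U ζ = T) =
        C.filter (fun ζ => ((∀ r ∈ insert h (↑(J \ T) : Set V), hull ends ζ r ⊆ U) ∧
          (∀ u ∈ (↑T : Set V), ¬ hull ends ζ u ⊆ U)) ∧ P' ζ) := by
    intro P' _
    ext ζ
    simp only [Finset.mem_filter]
    constructor
    · rintro ⟨⟨hζ, hP⟩, hesc⟩
      exact ⟨hζ, (mem_fibreE_iff hTJ hζ).1 hesc, hP⟩
    · rintro ⟨hζ, hpart, hP⟩
      exact ⟨⟨hζ, hP⟩, (mem_fibreE_iff hTJ hζ).2 hpart⟩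
  rw [hfib (fun ζ => redEdges ends ζ h ∈ 𝓔), hfib (fun ζ => blueEdges ends ζ h ∈ 𝓔)]
  have main := rigidOK_g_of_weakCubeBlocks_part (hwb T hTJ) h𝓔
  rw [hC]; convert main using 3; rfl


section Graph

/-- **THE MULTI-JUNCTION CLASS FROM WEAK-CUBE BLOCKS ON THE GRAPH.** -/
theorem gTypedSwAll_of_junctions_weakCubes {J : Finset V} (hlh : l ≠ h)
    (hwb : ∀ ξ, ∀ T ⊆ J, WeakCubeBlocks ends l h 𝓤 𝓓 𝓓'' X 𝓤' ({l}ᶜ) ξ fun ζ =>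
      (∀ r ∈ insert h (↑(J \ T) : Set V), hull ends ζ r ⊆ ({l}ᶜ : Set V)) ∧
        (∀ u ∈ (↑T : Set V), ¬ hull ends ζ u ⊆ ({l}ᶜ : Set V))) :
    GTypedSwAll ends l h 𝓤 𝓓 𝓓'' X 𝓤' :=
  exists_swAll_injection_of_card_le h _ (card_le_g_of_classes hlh fun ξ _ h𝓔 =>
    rigidOK_g_of_junctions_weakCubes (J := J) (hwb ξ) h𝓔)


end Graph

section MarkStep

variable {x : V}

/-- **THE GENERAL MARK STEP FROM WEAK-CUBE BLOCKS**: row 2′SW-ALL with the mark `x` on every graph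
under the weak-cube block structure on every fibre of every pattern of the mark's edges — the
hypothesis the census certifies for design 19's blocks (c3 / c6 / c7 with c2 / c5) and for the
block finder's covers (mining/night-4/g36/blockfind.py). -/
theorem swAll_markStep_of_junctions_weakCubes (hlh : l ≠ h) (hxl : x ≠ l) (hxh : x ≠ h)
    {J : Finset V}
    (hwb : ∀ d : Config E, ∀ ξ, ∀ T ⊆ J, WeakCubeBlocks (isolate ends x) l h (markU ends d x)
      (markD ends d x) (markD'' ends d x) {x} Set.univ ({l}ᶜ) ξ fun ζ =>
        (∀ r ∈ insert h (↑(J \ T) : Set V), hull (isolate ends x) ζ r ⊆ ({l}ᶜ : Set V)) ∧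
          (∀ u ∈ (↑T : Set V), ¬ hull (isolate ends x) ζ u ⊆ ({l}ᶜ : Set V))) :
    SwAll ends l h x := by
  refine swAll_of_gTyped_patterns hxl hxh fun d _ => ?_
  exact gTypedSwAll_of_junctions_weakCubes (J := J) hlh (hwb d)

/-- **Row (SW) from the general mark step from weak-cube blocks.** -/
theorem sw_markStep_of_junctions_weakCubes (hlh : l ≠ h) (hxl : x ≠ l) (hxh : x ≠ h)
    {J : Finset V}
    (hwb : ∀ d : Config E, ∀ ξ, ∀ T ⊆ J, WeakCubeBlocks (isolate ends x) l h (markU ends d x)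
      (markD ends d x) (markD'' ends d x) {x} Set.univ ({l}ᶜ) ξ fun ζ =>
        (∀ r ∈ insert h (↑(J \ T) : Set V), hull (isolate ends x) ζ r ⊆ ({l}ᶜ : Set V)) ∧
          (∀ u ∈ (↑T : Set V), ¬ hull (isolate ends x) ζ u ⊆ ({l}ᶜ : Set V))) :
    Sw ends l h x :=
  sw_of_swAll ends (swAll_markStep_of_junctions_weakCubes hlh hxl hxh hwb)


end MarkStep

end Blocks

end LocRows

end Summit.Ventures.PercRepro2
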